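import Literature.NumberTheory.EllipticCurves.BurungaleSkinnerTianWan2024.SignedMainStatementRankOneBSDOPEN
import Literature.NumberTheory.EllipticCurves.BurungaleSkinnerTianWan2024.QuadraticTwistPPartOPEN
import HarnessLib

/-!
# Burungale–Skinner–Tian–Wan (arXiv:2409.01350v2, PREPRINT), §10.1.1 Thm. 10.1 (body form of the
# Introduction's Thm. 1.3) for an elliptic curve, BOTH clauses — the semistable clause AND the
# quadratic-twist clause "discriminant coprime to `Np`" — as OPEN claim-tagged binders whose CONCLUSION
# is Kobayashi's signed statement in the tree's Literature currency `SignedCharIdealEqPadicLFunctionNeron`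

Written by the typer seat `bsd-littype-01` (gen 3) of the cross-ladder literature-typing layer
(D-0088(4); cell `run/shared/lean/pub/bsd-littype/`). HONEST FRAMING: UNREFEREED preprint ⇒
explicitly labelled OPEN hypotheses only (`def … : Prop`, `[claim: …, status: under-review]`), NEVER
theorems, NEVER `[cite:]`-facts; nothing asserted about any curve; nothing booked; no `_holds`. No new
notion: the conclusion is the predicate-with-body `SignedCharIdealEqPadicLFunctionNeron W p ε` of the
companion file `SignedMainStatementRankOneBSDOPEN.lean` (Kobayashi's "`Char(Sel^±(E/F_∞)^∨) =
(L_p^±(E, X))`", Néron normalisation, over `Kobayashi2003.IsSignedPAdicLFunction` /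
`Kobayashi2003.SignedSelmerDualData`).

WHY (the typed gap this closes). The SEMISTABLE clause of Thm. 1.3 = Thm. 10.1 is already typed
SUMMITS-side as `Summit.BirchSwinnertonDyer.Rank1Residual.Supersingular.BurungaleSkinnerTianWan2024_thm13_OPEN`
(`Supersingular/KobayashiMainConj….lean`; conclusion `∀ ε, KobayashiMainConj… W p ε`, a Summits-side
node over the Summits-side `IsPollackPair`) — "the twist clause is not included" there, and a Literature
file cannot import it. The typing-layer sheets of this seat (gens 0, 2) therefore carried "Thm. 1.3 /
Thm. 10.1 TWIST clause at main-conj. level" as a GAP row (only its `p`-part-of-BSD consequences were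
typed: `thm15_twist_pPart_OPEN`, `cor102_twist_pPart_OPEN`). With the Literature signed currency the
main-conj.-level twist clause is typable, and it is typed here together with a Literature twin of the
semistable clause (so that Literature consumers — e.g. the supersingular branch of Prop. 11.11,
`prop1111_pPart_rankOne_of_signedMainStatements_supersingular_OPEN` — can be fed by name). The
Summits bridge `BurungaleSkinnerTianWan2024_thm13_OPEN ↔ thm101_signedMainStatement_semistable_OPEN`
is the two-line dictionary `IsPollackPair f p L⁺ L⁻ ↔ IsSignedPAdicLFunction f p 1 L⁻ ∧
IsSignedPAdicLFunction f p (−1) L⁺ ∧ L^± ≠ 0` (plus (h4) ↔ `a_p = 0`,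
`frobeniusTrace_eq_zero_of_goodSS_of_h4`); it belongs Summits-side and is NOT restated here.

## The printed statement (arXiv:2409.01350v2, p. 86; TeX label `KoMC_r`, tex l.7315–7326)

> **Theorem 10.1.** Let `g ∈ S₂(Γ₀(N))` be an elliptic newform with `N` square-free, and `p ∤ 2N` a
> prime of supersingular reduction. Then Kobayashi's main Conj[.] 9.4 is true, that is,
> `(𝓛_p^∘(g)) = ξ(X_∘(g))` for `∘ ∈ {+, −}`. Moreover, the same holds for `g_K := g ⊗ χ_K` for any
> quadratic field extension `K/ℚ` with discriminant coprime to `Np`.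

§9.1 (tex l.6680): "Let `p ∤ 2N` be a non-ordinary prime so that `a_g(p) = 0`, which we refer to as a
supersingular prime"; Introduction Thm. 1.3 (p. 3): "`E/ℚ` semistable, `p > 2` a supersingular prime.
If `p = 3`, suppose that (h4) [`a_3(E) = 0`, (1.7)] holds. Then Kobayashi's Conj[.] 1.2 is true … The
same conclusion holds for quadratic twists of `E` by quadratic fields `K` with discriminant coprime
to `Np` and divisible only by primes of ordinary reduction for `E`" (the Introduction's narrower twist
wording; this file types the BODY wording, exactly as `cor102_twist_pPart_OPEN` does for Cor. 10.2 —
OPEN-QUESTIONS-01 Q4/Q16; body ⟹ intro). Statement 9.4 (label `KatopLss`, p. 80): "(a) `X_∘(g)` is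
`Λ_{𝒪_λ}`-torsion. (b) For `γ = γ_g` as in Lemma 2.5, we have an equality of ideals
`(𝓛^∘_γ(g)) = ξ(X_∘(g))` in `Λ_{𝒪_λ}`."

## Transcription (elliptic-curve instance `g = f_E`, `𝒪_λ = ℤ_p`)

* Semistable clause: `W` globally minimal, `Semistable W` ("`N` square-free" for an elliptic newform
  = every bad prime multiplicative), `p ≠ 2`, good reduction at `p` with `a_p = 0`
  (`W.frobeniusTrace p = 0`, the body's "supersingular prime"); conclusion: for BOTH signs `ε`,
  `SignedCharIdealEqPadicLFunctionNeron W p ε`.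
* Twist clause: `W₀` as above; `K = ℚ(√d)`, `d ≠ 1` square-free (so `disc K ∈ {d, 4d}`); "discriminant
  coprime to `Np`" ↦ every prime `q` ramified in `K` (`RamifiedInQuadratic d q`: `q ∣ d`, or `q = 2`
  and `d ≢ 1 (mod 4)`) has `q ≠ p` and `q ∤ N_{E₀}` — verbatim the spelling of `cor102_twist_pPart_OPEN`;
  `W` a globally minimal model of the twist, `C • W = W₀.quadraticTwist d`; conclusion: for both signs,
  `SignedCharIdealEqPadicLFunctionNeron W p ε` (the twist has good reduction at `p ∤ d` with
  `a_p(E₀^{(d)}) = χ_d(p) a_p(E₀) = 0`; not needed syntactically).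
* READING FLAG `BSTW-1111-lattice` (as in both Prop. 11.11 files): print states 9.4 for `γ_g` = the
  OPTIMAL (Néron-of-`E_•`) periods of the `(𝒪,λ)`-optimally parametrised curve of the class; the
  predicate uses the Néron period of the GIVEN globally minimal `W`; at a supersingular `p ∤ 2N`
  (`E[p]` irreducible, so the class has no `p`-isogeny; `p ∤` Manin constant, Mazur 1978 /
  Abbes–Ullmo 1996) the two differ by a `p`-adic unit — published, not restated; so the binders are
  EQUIVALENT to print on this point, and otherwise WEAKER-OR-EQUAL (both signs asked jointly is what
  print states: "for `∘ ∈ {+, −}`").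

WHAT IS NOT CLAIMED: nothing at `p = 2`; nothing at `p = 3` with `a_3 = ±3`; nothing for
non-semistable `E` other than the prime-to-`Np` twists of semistable curves; no `_holds`.

## References
* [BurungaleSkinnerTianWan2024] arXiv:2409.01350v2: Thm. 10.1 (p. 86; label KoMC_r, tex l.7315),
  Thm. 1.3 and Rem. 1.4 (pp. 3–4), statement 9.4 (p. 80; label KatopLss), §9.1 (tex l.6680), Lemma 2.5,
  Rem. 2.3; proof §10.3 (p. 88).
* [Kobayashi2003] Invent. Math. 152 (2003), Main Conj. (p. 2) — tree `Kobayashi2003/*`.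
* Tree: Summits-side `BurungaleSkinnerTianWan2024_thm13_OPEN` (semistable clause, Summits currency);
  Literature `thm15_pPart_OPEN` / `thm15_twist_pPart_OPEN` / `cor102_twist_pPart_OPEN` (the
  `p`-part-of-BSD consequences, Thm. 1.5 / Cor. 10.2).
-/

noncomputable section

open scoped Classical

open WeierstrassCurve Literature.NumberTheory.EllipticCurves
  Literature.NumberTheory.EllipticCurves.ModularForms
  Literature.NumberTheory.EllipticCurves.Rank1Residual

namespace Literature.NumberTheory.EllipticCurves.BurungaleSkinnerTianWan2024

/-- **OPEN HYPOTHESIS — UNREFEREED PREPRINT (arXiv:2409.01350v2), Thm. 10.1, SEMISTABLE clause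
(p. 86).** "Let `g ∈ S₂(Γ₀(N))` be an elliptic newform with `N` square-free, and `p ∤ 2N` a prime of
supersingular reduction [`a_p(g) = 0`, §9.1]. Then Kobayashi's main Conj[.] 9.4 is true, that is,
`(𝓛_p^∘(g)) = ξ(X_∘(g))` for `∘ ∈ {+, −}`." Transcribed for `g = f_E`: `W` globally minimal,
`Semistable W`, `p ≠ 2`, good at `p`, `a_p = 0`; conclusion `SignedCharIdealEqPadicLFunctionNeron W p ε`
for every sign `ε` (Néron normalisation; READING FLAG `BSTW-1111-lattice`, module docstring).
Literature twin of the Summits-side `BurungaleSkinnerTianWan2024_thm13_OPEN` (which is phrased with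
`GoodSS W p ∧ (p = 3 → a_3 = 0)`; `frobeniusTrace_eq_zero_of_goodSS_of_h4` converts). NEVER cite this
`Prop` as a theorem (Rem. 1.4 (i): supersedes Wan's withdrawn signed main-conj. preprint; no journal
version, 2026-08-26); take it as an explicit hypothesis. [claim: BurungaleSkinnerTianWan2024, status: under-review]
[cite: BurungaleSkinnerTianWan2024, Thm. 10.1, first sentence (p. 86; label KoMC_r, tex l.7315; ANNOUNCED, OPEN binder)] -/
def thm101_signedMainStatement_semistable_OPEN : Prop :=
  ∀ (W : WeierstrassCurve ℚ) [W.IsElliptic] [W.IsGloballyMinimal] (p : ℕ) [Fact p.Prime],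
    p ≠ 2 → Semistable W → W.HasGoodReductionAtPrime p → W.frobeniusTrace p = 0 →
      ∀ ε : ℤˣ, SignedCharIdealEqPadicLFunctionNeron W p ε

/-- **OPEN HYPOTHESIS — UNREFEREED PREPRINT (arXiv:2409.01350v2), Thm. 10.1, QUADRATIC-TWIST clause
(p. 86).** "Moreover, the same holds for `g_K := g ⊗ χ_K` for any quadratic field extension `K/ℚ` with
discriminant coprime to `Np`" (`g` an elliptic newform of square-free level `N`, `p ∤ 2N` with
`a_p(g) = 0`). Transcribed (module docstring): `W₀` globally minimal, `Semistable W₀`, `p ≠ 2`, good at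
`p`, `a_p(E₀) = 0`; `K = ℚ(√d)`, `d ≠ 1` square-free, every prime ramified in `K` is `≠ p` and `∤ N_{E₀}`
(`RamifiedInQuadratic`, the spelling of `cor102_twist_pPart_OPEN`); `W` a globally minimal model of
`E₀ ⊗ χ_K = E₀^{(d)}` (`C • W = W₀.quadraticTwist d`); conclusion: `SignedCharIdealEqPadicLFunctionNeron W p ε`
for every sign `ε`. Proof in print: §10.3 ("The same argument applies for the quadratic twist `g_K`"),
resting on Thm. 9.24's twist clause ("not explicitly covered by the results of [W1, CLW], but
essentially the same argument applies", p. 86) — OPEN-QUESTIONS-01 Q17. NEVER cite this `Prop` as a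
theorem; take it as an explicit hypothesis. [claim: BurungaleSkinnerTianWan2024, status: under-review]
[cite: BurungaleSkinnerTianWan2024, Thm. 10.1, last sentence (p. 86; label KoMC_r, tex l.7324; ANNOUNCED, OPEN binder)] -/
def thm101_twist_signedMainStatement_OPEN : Prop :=
  ∀ (W₀ W : WeierstrassCurve ℚ) [W₀.IsElliptic] [W₀.IsGloballyMinimal] [W.IsElliptic]
    [W.IsGloballyMinimal] (p : ℕ) [Fact p.Prime] (d : ℤ) (C : VariableChange ℚ),
    p ≠ 2 → Semistable W₀ → W₀.HasGoodReductionAtPrime p → W₀.frobeniusTrace p = 0 →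
    Squarefree d → d ≠ 1 →
    (∀ (q : ℕ) [Fact q.Prime], RamifiedInQuadratic d q → q ≠ p ∧ ¬ q ∣ W₀.conductorNorm ℤ) →
    C • W = W₀.quadraticTwist (d : ℚ) →
      ∀ ε : ℤˣ, SignedCharIdealEqPadicLFunctionNeron W p ε

/-! ### Bookkeeping (binder ⇒ shape), all CONDITIONAL on the OPEN binders; nothing is closed -/

/-- **Introduction wording ⇒ body wording** (semistable clause): granted the binder, "supersingular
with (1.7) if `p = 3`" (`GoodSS W p`, `p = 3 → a_3 = 0` — the hypothesis list of the Summits-side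
`BurungaleSkinnerTianWan2024_thm13_OPEN` and of `thm15_pPart_OPEN`) yields the signed statement for
both signs. [claim: BurungaleSkinnerTianWan2024, status: under-review]
[cite: BurungaleSkinnerTianWan2024, Thm. 1.3 (p. 3) and Thm. 10.1 (p. 86) (OPEN binder; bookkeeping)] -/
theorem signedCharIdealEq_of_thm101_OPEN_of_goodSS (hBSTW_OPEN : thm101_signedMainStatement_semistable_OPEN)
    (W : WeierstrassCurve ℚ) [W.IsElliptic] [W.IsGloballyMinimal] (p : ℕ) [Fact p.Prime]
    (hp : p ≠ 2) (hsst : Semistable W) (hss : GoodSS W p) (h4 : p = 3 → W.frobeniusTrace 3 = 0)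
    (ε : ℤˣ) : SignedCharIdealEqPadicLFunctionNeron W p ε :=
  hBSTW_OPEN W p hp hsst hss.1 (frobeniusTrace_eq_zero_of_goodSS_of_h4 W p hp hss h4) ε

/-- **Granted the semistable binder: the EISENSTEIN HALF for every sign** — for every admissible
`(κ, γ, f, ϖ)`, every Kobayashi `L_p^ε` and every datum `D` of `Sel^ε(E/ℚ_∞)`, `char X^ε = (g)` with
`ι g = ϖ · ι(L · h)` for some `h ∈ Λ` (here `h = 1`): the Literature shape of the Summits-side
`KobayashiLowerDivisibility W p ε`, the input the rank-`0` `p`-part of BSD on class X6 consumes.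
CONDITIONAL; closes nothing. [claim: BurungaleSkinnerTianWan2024, status: under-review]
[cite: BurungaleSkinnerTianWan2024, Thm. 10.1 (p. 86) (OPEN binder; bookkeeping)] [cite: Kobayashi2003, Main Conj. (p. 2) (shape only)] -/
theorem exists_generator_eq_mul_of_thm101_OPEN (hBSTW_OPEN : thm101_signedMainStatement_semistable_OPEN)
    {W : WeierstrassCurve ℚ} [W.IsElliptic] [W.IsGloballyMinimal] {p : ℕ} [Fact p.Prime]
    (hp : p ≠ 2) (hsst : Semistable W) (hgood : W.HasGoodReductionAtPrime p)
    (hap : W.frobeniusTrace p = 0) (ε : ℤˣ) {κ : ZpExtension ℚ p}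
    {γ : Field.absoluteGaloisGroup ℚ} (hκ : κ.IsCyclotomic) (hγ : κ.IsTopGenerator γ)
    (hγ' : IsCyclotomicVariable p γ) [NeZero (W.conductorNorm ℤ)]
    {f : CuspForm (CongruenceSubgroup.Gamma0 (W.conductorNorm ℤ)) 2} (hf : IsNewformOf W f) {ϖ : ℚ}
    (hϖ : (ϖ : ℝ) * W.realPeriodRat = plusPeriod f) {L : IwasawaAlgebra p}
    (hL : Kobayashi2003.IsSignedPAdicLFunction f p ε L)
    (D : Kobayashi2003.SignedSelmerDualData W κ γ ε) :
    ∃ g h' : IwasawaAlgebra p, D.charIdeal = Ideal.span {g} ∧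
      iwasawaToPowerSeries p g =
        PowerSeries.C (ϖ : ℚ_[p]) * iwasawaToPowerSeries p (L * h') :=
  (hBSTW_OPEN W p hp hsst hgood hap ε).exists_generator_eq_mul hκ hγ hγ' hf hϖ hL D

/-- **The twist clause feeds the supersingular Prop. 11.11 binder's main-conj. hypotheses**: granted
the twist binder, a prime-to-`Np` quadratic twist `W` of a semistable `W₀` (good at `p`, `a_p = 0`)
satisfies `∀ ε, SignedCharIdealEqPadicLFunctionNeron W p ε` — the shape of the hypotheses `hMC`, `hMC'`
of `pPart_of_prop1111_supersingular_OPEN`. (For such twists the rank-`≤ 1` `p`-part of BSD is already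
the binder `cor102_twist_pPart_OPEN`; this edge only records the main-conj.-level provenance.)
CONDITIONAL; closes nothing. [claim: BurungaleSkinnerTianWan2024, status: under-review]
[cite: BurungaleSkinnerTianWan2024, Thm. 10.1, last sentence (p. 86) (OPEN binder; bookkeeping)] -/
theorem signedCharIdealEq_twist_of_thm101_twist_OPEN (hBSTW_OPEN : thm101_twist_signedMainStatement_OPEN)
    (W₀ W : WeierstrassCurve ℚ) [W₀.IsElliptic] [W₀.IsGloballyMinimal] [W.IsElliptic]
    [W.IsGloballyMinimal] (p : ℕ) [Fact p.Prime] {d : ℤ} {C : VariableChange ℚ}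
    (hp : p ≠ 2) (hsst : Semistable W₀) (hgood : W₀.HasGoodReductionAtPrime p)
    (hap : W₀.frobeniusTrace p = 0) (hd : Squarefree d) (hd1 : d ≠ 1)
    (hram : ∀ (q : ℕ) [Fact q.Prime], RamifiedInQuadratic d q → q ≠ p ∧ ¬ q ∣ W₀.conductorNorm ℤ)
    (hC : C • W = W₀.quadraticTwist (d : ℚ)) :
    ∀ ε : ℤˣ, SignedCharIdealEqPadicLFunctionNeron W p ε :=
  hBSTW_OPEN W₀ W p d C hp hsst hgood hap hd hd1 hram hC

end Literature.NumberTheory.EllipticCurves.BurungaleSkinnerTianWan2024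

end
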